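import Summits.BirchSwinnertonDyer.BirchSwinnertonDyer.Theorems.SignedLowerHalvesSprungLowerDivisibilityAtThreeKatoSporadicLedgerDoor
import Summits.BirchSwinnertonDyer.BirchSwinnertonDyer.Theorems.SignedLowerHalvesSprungLowerDivisibilityAtThreeCyclotomicPosLevelLedgerDoor
import Summits.BirchSwinnertonDyer.BirchSwinnertonDyer.Theorems.SignedLowerHalvesSprungLowerDivisibilityAtThreeIotaCyclotomicPairing
import Summits.BirchSwinnertonDyer.BirchSwinnertonDyer.Theorems.SignedLowerHalvesSprungLowerDivisibilityAtThreeCyclotomicLowerRestSplitDoors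
import HarnessLib

/-!
# Crux `SprungLowerDivisibilityAtThree` (item stmt-BirchSwinnertonDyer-19875), line `chromatic-common-zeros`, skeleton v8:
# THE OFF-`(T)` LEDGER DOOR — BOTH open research stubs K_spor `stub_katoFineLowerSporadic` AND S4b-cyc
# `stub_cyclotomicLowerPosLevel` from ONE pair: the cokernel bound F-α at every height-one `𝔭 ∌ p, T` that is a common
# zero, and the residue «`k ≤ x` on `{j < k}`» there

Cell `bsd-ssimc` (host), width seat `cruxlead-stmt-BirchSwinnertonDyer-19875-w3` (gen 6) under the 19875 LEAD; `--supports`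
stmt-BirchSwinnertonDyer-19875 `--as helper`; theorems only; closes NO item. HONEST FRAMING: a literal case split composing the
two doors `stub_katoFineLowerSporadic_of_ledgerDoor` (p648498) and `stub_cyclotomicLowerPosLevel_of_ledgerDoor` (sibling file);
K_spor, S4b-cyc, K1, leaf X8 and BSD are NOT proved by anything here.

THE POINT (for the LEAD's child skeletons on 22569 `KatoFineLowerSporadicX8` and 22570 `CyclotomicLowerRestX8R`). The cokernel
bound F-α «`min_• ℓ_𝔭(Λ ⧸ range C•.colMap) ≤ ℓ_𝔭 Y.X`» is in print at EVERY height-one `𝔭 ≠ (T)` off the Tate lines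
(joint Coleman cokernel `= Λ/(T)`; Poitou–Tate; Wingberg/Matar WITH the `ι`; x8 lit T63 (c)), i.e. at the sporadic primes
AND at the positive-level cyclotomic primes. Typed ONCE with the binders «height one, `p ∉ 𝔭`, `T ∉ 𝔭`, common zero», it
serves both stubs, and the line's off-`(T)` residue is ONE statement: «`ℓ_𝔭(𝐇¹/Z) ≤ ℓ_𝔭 X₀` wherever the zeta index
exceeds the local index» (Kato 12.10 ⊆ / Sprung 7.21 ⊆ content; conjecturally EMPTY in both families: Sprung 2015 Conj. 5.6
for the sporadic one, Rohrlich-finite exceptional zeros for the cyclotomic one). S4b-T (`𝔭 = (T)`, `r_an ≥ 2`) is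
untouched: `(T)` is exactly where the joint Coleman cokernel lives.
* `stubs_offT_of_ledgerDoor (hFα) (hres) : K_spor ∧ S4b-cyc` (both registered signatures VERBATIM). Inside: `T ∉ 𝔭` at a
  sporadic prime is `ω₀ = T ∉ 𝔭`; `3 ∉ (Φ_{3^j}(1+T))` is `ChromaticIota.natCast_not_mem_span_cyclotomic` (w3 g5).

References: [Kato2004Asterisque] Conj. 12.10 (p. 224), (17.13.1) (p. 280); [Sprung2012] §7.1 Props. 7.3/7.6, Prop. 7.19, Main Conj.
7.21 (p. 1505); [KuriharaPollack2007] Prop. 1.2; [LeiSujatha2021] (SES-KP); [Wingberg1989] Cor. 2.5 / [Matar2020] Thm. 1.1;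
[Sprung2015] Conj. 5.6; [Rohrlich1984]; tree: `…KatoSporadicLedgerDoor` (p648498), `…CyclotomicPosLevelLedgerDoor`,
`…IotaCyclotomicPairing` (p642657), `…CyclotomicCertDoor` (`prime_cyclotomic_comp`), `…CyclotomicLowerRestSplitDoors` (p621634).
-/

set_option linter.dupNamespace false
set_option autoImplicit false

noncomputable section

open scoped Classical NumberField MatrixGroups ModularForm Polynomial

open NumberField IsDedekindDomain CongruenceSubgroup WeierstrassCurve Field
  Literature.NumberTheory.EllipticCurves Literature.NumberTheory.EllipticCurves.ModularForms
  Literature.NumberTheory.EllipticCurves.ZpExtension Literature.NumberTheory.EllipticCurves.Sprung2017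
  Literature.NumberTheory.EllipticCurves.Sprung2012 Literature.NumberTheory.EllipticCurves.Rank1Residual
  Literature.NumberTheory.EllipticCurves.IwasawaAlgebra Literature.NumberTheory.EllipticCurves.Kato2004
  Literature.NumberTheory.EllipticCurves.Module
  Summit.BirchSwinnertonDyer.BirchSwinnertonDyer.Theorems
  Summit.BirchSwinnertonDyer.BirchSwinnertonDyer.Theorems.SmallImageSignedMuDefect

namespace Summit.BirchSwinnertonDyer.BirchSwinnertonDyer.Theorems.ChromaticCommonZeros

/-- **At a positive-level cyclotomic prime of `Λ = ℤ₃⟦T⟧`, `3 ∉ 𝔭`:** a height-one `𝔭 ∋ Φ_{3^j}(1+T)` (`j ≥ 1`) is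
`(Φ_{3^j}(1+T))` (a prime element, `prime_cyclotomic_comp`), which does not contain `3` (w3 g5's
`ChromaticIota.natCast_not_mem_span_cyclotomic`). [cite: Washington1997, §7.1 and §13.2] -/
theorem natCast_not_mem_of_cyclotomic_comp_mem (𝔭 : PrimeSpectrum (IwasawaAlgebra 3)) (h𝔭 : 𝔭.asIdeal.height = 1)
    {j : ℕ} (hj : 1 ≤ j)
    (hΦ : ((((Polynomial.cyclotomic (3 ^ j) ℤ).comp (Polynomial.X + 1)).map (Int.castRingHom ℤ_[3]) :
      Polynomial ℤ_[3]) : PowerSeries ℤ_[3]) ∈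
      𝔭.asIdeal) :
    ((3 : ℕ) : IwasawaAlgebra 3) ∉ 𝔭.asIdeal := by
  obtain ⟨k, rfl⟩ : ∃ k, j = k + 1 := ⟨j - 1, by omega⟩
  rw [Ideal.eq_span_singleton_of_height_eq_one h𝔭 hΦ (prime_cyclotomic_comp (p := 3) k)]
  exact ChromaticIota.natCast_not_mem_span_cyclotomic k

/-- **THE OFF-`(T)` LEDGER DOOR: K_spor ∧ S4b-cyc ⟸ F-α ∧ R off `(T)`.** Over the joint colour-free binders of the line
(X8 pair, cyclotomic/Honda setting, newform and Sprung pair, `I, Cs, Cf` with `Cs.Z = Cf.Z`, a fine dual datum `Y`) and a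
height-one prime `𝔭` with `p ∉ 𝔭`, `T ∉ 𝔭` at which every colour's normalised `L`-function vanishes:
(hFα) the COKERNEL BOUND `min_• ℓ_𝔭(Λ ⧸ range C•.colMap) ≤ ℓ_𝔭 Y.X` (displayed; the typer's signature — joint Coleman
cokernel `Λ/(T)` + Poitou–Tate + Wingberg/Matar WITH `ι`, print-exact per x8 lit T63 (c); Tate-line side condition to be
absorbed as in `stub_katoFineLowerSporadic_of_ledgerDoor_off`); (hres) the RESIDUE «`ℓ_𝔭(I.H ⧸ Cs.Z) ≤ ℓ_𝔭 Y.X` where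
`min_• ℓ_𝔭(Λ ⧸ range C•.colMap) < ℓ_𝔭(I.H ⧸ Cs.Z)`». THEN both registered research stubs of skeleton v8 hold VERBATIM:
K_spor `stub_katoFineLowerSporadic` (:153; `ω₀ = T`) and S4b-cyc `stub_cyclotomicLowerPosLevel` (:206; `3 ∉ (Φ_{3^j}(1+T))`,
then `eisenstein_iff_fine`). Nothing is discharged. [cite: Kato2004Asterisque, Conj. 12.10 (p. 224), (17.13.1) (p. 280)]
[cite: Sprung2012, §7.1, Props. 7.3/7.6, Prop. 7.19, Main Conj. 7.21 (p. 1505)] [cite: Wingberg1989, Cor. 2.5] [cite: Matar2020, Thm. 1.1] -/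
theorem stubs_offT_of_ledgerDoor
    (hFα : ∀ (W : WeierstrassCurve ℚ) [W.IsElliptic] [W.IsGloballyMinimal] (p : ℕ) [Fact p.Prime]
      [ContinuousSMul ℤ_[p] (W.tateModule p)] [Module.Free ℤ_[p] (W.tateModule p)]
      [Module.Finite ℤ_[p] (W.tateModule p)],
      ClassX8 W p → ∀ (κ : ZpExtension ℚ p) (γ : Field.absoluteGaloisGroup ℚ),
      κ.IsCyclotomic → κ.IsTopGenerator γ → IsCyclotomicVariable p γ →
    ∀ (v : HeightOneSpectrum (𝓞 ℚ)), (p : 𝓞 ℚ) ∈ v.asIdeal →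
    ∀ (g : Field.absoluteGaloisGroup (v.adicCompletion ℚ)),
      κ.IsTopGenerator (resGalOfEmb (closureEmb (K := ℚ) (v.adicCompletion ℚ)) g) →
    ∀ (cneg : localPoints W (v.adicCompletion ℚ)) (c : ℕ → localPoints W (v.adicCompletion ℚ)),
      IsHondaSystem κ (closureEmb (K := ℚ) (v.adicCompletion ℚ)) W (W.frobeniusTrace p) g cneg c →
    ∀ (N : ℕ) (_ : NeZero N) (f : CuspForm (Gamma0 N) 2) (ϖ : ℚ) (Lsharp Lflat : IwasawaAlgebra p),
      IsNewformOf W f → (ϖ : ℝ) * W.realPeriodRat = plusPeriod f →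
      IsSprungPair f p (W.frobeniusTrace p) Lsharp Lflat →
    ∀ (I : Kato2004.IwasawaH1Data W p κ γ)
      (Cs : SharpFlatColemanKatoData W p f ϖ κ γ (closureEmb (K := ℚ) (v.adicCompletion ℚ))
        (W.frobeniusTrace p) g c Chroma.sharp I)
      (Cf : SharpFlatColemanKatoData W p f ϖ κ γ (closureEmb (K := ℚ) (v.adicCompletion ℚ))
        (W.frobeniusTrace p) g c Chroma.flat I),
      Cs.Z = Cf.Z →
    ∀ (Y : W.FineSelmerDualData κ γ) (𝔭 : PrimeSpectrum (IwasawaAlgebra p)), 𝔭.asIdeal.height = 1 →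
      (p : IwasawaAlgebra p) ∉ 𝔭.asIdeal → (PowerSeries.X : IwasawaAlgebra p) ∉ 𝔭.asIdeal →
      (∀ (col' : Chroma) (G' : IwasawaAlgebra p),
        iwasawaToPowerSeries p G' =
          PowerSeries.C (ϖ : ℚ_[p]) * iwasawaToPowerSeries p (chromaticL col' Lsharp Lflat) →
        G' ∈ 𝔭.asIdeal) →
      min (Module.lengthAt (IwasawaAlgebra p) (IwasawaAlgebra p ⧸ LinearMap.range Cs.colMap) 𝔭)
          (Module.lengthAt (IwasawaAlgebra p) (IwasawaAlgebra p ⧸ LinearMap.range Cf.colMap) 𝔭) ≤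
        Module.lengthAt (IwasawaAlgebra p) Y.X 𝔭)
    (hres : ∀ (W : WeierstrassCurve ℚ) [W.IsElliptic] [W.IsGloballyMinimal] (p : ℕ) [Fact p.Prime]
      [ContinuousSMul ℤ_[p] (W.tateModule p)] [Module.Free ℤ_[p] (W.tateModule p)]
      [Module.Finite ℤ_[p] (W.tateModule p)],
      ClassX8 W p → ∀ (κ : ZpExtension ℚ p) (γ : Field.absoluteGaloisGroup ℚ),
      κ.IsCyclotomic → κ.IsTopGenerator γ → IsCyclotomicVariable p γ →
    ∀ (v : HeightOneSpectrum (𝓞 ℚ)), (p : 𝓞 ℚ) ∈ v.asIdeal →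
    ∀ (g : Field.absoluteGaloisGroup (v.adicCompletion ℚ)),
      κ.IsTopGenerator (resGalOfEmb (closureEmb (K := ℚ) (v.adicCompletion ℚ)) g) →
    ∀ (cneg : localPoints W (v.adicCompletion ℚ)) (c : ℕ → localPoints W (v.adicCompletion ℚ)),
      IsHondaSystem κ (closureEmb (K := ℚ) (v.adicCompletion ℚ)) W (W.frobeniusTrace p) g cneg c →
    ∀ (N : ℕ) (_ : NeZero N) (f : CuspForm (Gamma0 N) 2) (ϖ : ℚ) (Lsharp Lflat : IwasawaAlgebra p),
      IsNewformOf W f → (ϖ : ℝ) * W.realPeriodRat = plusPeriod f →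
      IsSprungPair f p (W.frobeniusTrace p) Lsharp Lflat →
    ∀ (I : Kato2004.IwasawaH1Data W p κ γ)
      (Cs : SharpFlatColemanKatoData W p f ϖ κ γ (closureEmb (K := ℚ) (v.adicCompletion ℚ))
        (W.frobeniusTrace p) g c Chroma.sharp I)
      (Cf : SharpFlatColemanKatoData W p f ϖ κ γ (closureEmb (K := ℚ) (v.adicCompletion ℚ))
        (W.frobeniusTrace p) g c Chroma.flat I),
      Cs.Z = Cf.Z →
    ∀ (Y : W.FineSelmerDualData κ γ) (𝔭 : PrimeSpectrum (IwasawaAlgebra p)), 𝔭.asIdeal.height = 1 →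
      (p : IwasawaAlgebra p) ∉ 𝔭.asIdeal → (PowerSeries.X : IwasawaAlgebra p) ∉ 𝔭.asIdeal →
      (∀ (col' : Chroma) (G' : IwasawaAlgebra p),
        iwasawaToPowerSeries p G' =
          PowerSeries.C (ϖ : ℚ_[p]) * iwasawaToPowerSeries p (chromaticL col' Lsharp Lflat) →
        G' ∈ 𝔭.asIdeal) →
      min (Module.lengthAt (IwasawaAlgebra p) (IwasawaAlgebra p ⧸ LinearMap.range Cs.colMap) 𝔭)
          (Module.lengthAt (IwasawaAlgebra p) (IwasawaAlgebra p ⧸ LinearMap.range Cf.colMap) 𝔭) <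
          Module.lengthAt (IwasawaAlgebra p) (I.H ⧸ Cs.Z) 𝔭 →
      Module.lengthAt (IwasawaAlgebra p) (I.H ⧸ Cs.Z) 𝔭 ≤ Module.lengthAt (IwasawaAlgebra p) Y.X 𝔭) :
    (∀ (W : WeierstrassCurve ℚ) [W.IsElliptic] [W.IsGloballyMinimal] (p : ℕ) [Fact p.Prime]
      [ContinuousSMul ℤ_[p] (W.tateModule p)] [Module.Free ℤ_[p] (W.tateModule p)]
      [Module.Finite ℤ_[p] (W.tateModule p)],
      ClassX8 W p → ∀ (κ : ZpExtension ℚ p) (γ : Field.absoluteGaloisGroup ℚ),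
      κ.IsCyclotomic → κ.IsTopGenerator γ → IsCyclotomicVariable p γ →
    ∀ (v : HeightOneSpectrum (𝓞 ℚ)), (p : 𝓞 ℚ) ∈ v.asIdeal →
    ∀ (g : Field.absoluteGaloisGroup (v.adicCompletion ℚ)),
      κ.IsTopGenerator (resGalOfEmb (closureEmb (K := ℚ) (v.adicCompletion ℚ)) g) →
    ∀ (cneg : localPoints W (v.adicCompletion ℚ)) (c : ℕ → localPoints W (v.adicCompletion ℚ)),
      IsHondaSystem κ (closureEmb (K := ℚ) (v.adicCompletion ℚ)) W (W.frobeniusTrace p) g cneg c →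
    ∀ (N : ℕ) (_ : NeZero N) (f : CuspForm (Gamma0 N) 2) (ϖ : ℚ) (Lsharp Lflat : IwasawaAlgebra p),
      IsNewformOf W f → (ϖ : ℝ) * W.realPeriodRat = plusPeriod f →
      IsSprungPair f p (W.frobeniusTrace p) Lsharp Lflat →
    ∀ (I : Kato2004.IwasawaH1Data W p κ γ)
      (Cs : SharpFlatColemanKatoData W p f ϖ κ γ (closureEmb (K := ℚ) (v.adicCompletion ℚ))
        (W.frobeniusTrace p) g c Chroma.sharp I)
      (Cf : SharpFlatColemanKatoData W p f ϖ κ γ (closureEmb (K := ℚ) (v.adicCompletion ℚ))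
        (W.frobeniusTrace p) g c Chroma.flat I),
      Cs.Z = Cf.Z →
    ∀ (Y : W.FineSelmerDualData κ γ) (𝔭 : PrimeSpectrum (IwasawaAlgebra p)), 𝔭.asIdeal.height = 1 →
      (p : IwasawaAlgebra p) ∉ 𝔭.asIdeal →
      (¬ ∃ n : ℕ, ((cyclotomicOmega p n).map (Int.castRingHom ℤ_[p]) : PowerSeries ℤ_[p]) ∈ 𝔭.asIdeal) →
      (∀ (col' : Chroma) (G' : IwasawaAlgebra p),
        iwasawaToPowerSeries p G' =
          PowerSeries.C (ϖ : ℚ_[p]) * iwasawaToPowerSeries p (chromaticL col' Lsharp Lflat) →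
        G' ∈ 𝔭.asIdeal) →
      Module.lengthAt (IwasawaAlgebra p) (I.H ⧸ Cs.Z) 𝔭 ≤ Module.lengthAt (IwasawaAlgebra p) Y.X 𝔭) ∧
    (∀ (W : WeierstrassCurve ℚ) [W.IsElliptic] [W.IsGloballyMinimal] (p : ℕ) [Fact p.Prime]
      [ContinuousSMul ℤ_[p] (W.tateModule p)] [Module.Free ℤ_[p] (W.tateModule p)]
      [Module.Finite ℤ_[p] (W.tateModule p)],
      ClassX8 W p → ∀ (col : Chroma) (κ : ZpExtension ℚ p) (γ : Field.absoluteGaloisGroup ℚ),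
      κ.IsCyclotomic → κ.IsTopGenerator γ → IsCyclotomicVariable p γ →
    ∀ (v : HeightOneSpectrum (𝓞 ℚ)), (p : 𝓞 ℚ) ∈ v.asIdeal →
    ∀ (g : Field.absoluteGaloisGroup (v.adicCompletion ℚ)),
      κ.IsTopGenerator (resGalOfEmb (closureEmb (K := ℚ) (v.adicCompletion ℚ)) g) →
    ∀ (cneg : localPoints W (v.adicCompletion ℚ)) (c : ℕ → localPoints W (v.adicCompletion ℚ)),
      IsHondaSystem κ (closureEmb (K := ℚ) (v.adicCompletion ℚ)) W (W.frobeniusTrace p) g cneg c →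
    ∀ (N : ℕ) (_ : NeZero N) (f : CuspForm (Gamma0 N) 2) (ϖ : ℚ) (Lsharp Lflat : IwasawaAlgebra p),
      IsNewformOf W f → (ϖ : ℝ) * W.realPeriodRat = plusPeriod f →
      IsSprungPair f p (W.frobeniusTrace p) Lsharp Lflat → chromaticL col Lsharp Lflat ≠ 0 →
    ∀ (D : SharpFlatSelmerDualData W κ γ (closureEmb (K := ℚ) (v.adicCompletion ℚ))
        (W.frobeniusTrace p) g c col) [Module.Finite (IwasawaAlgebra p) D.X],
      Module.IsTorsion (IwasawaAlgebra p) D.X →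
    ∀ (G : IwasawaAlgebra p),
      iwasawaToPowerSeries p G =
        PowerSeries.C (ϖ : ℚ_[p]) * iwasawaToPowerSeries p (chromaticL col Lsharp Lflat) →
    ∀ (I : Kato2004.IwasawaH1Data W p κ γ)
      (Cs : SharpFlatColemanKatoData W p f ϖ κ γ (closureEmb (K := ℚ) (v.adicCompletion ℚ))
        (W.frobeniusTrace p) g c Chroma.sharp I)
      (Cf : SharpFlatColemanKatoData W p f ϖ κ γ (closureEmb (K := ℚ) (v.adicCompletion ℚ))
        (W.frobeniusTrace p) g c Chroma.flat I),
      Cs.Z = Cf.Z →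
    ∀ 𝔭 : PrimeSpectrum (IwasawaAlgebra p), 𝔭.asIdeal.height = 1 →
      (PowerSeries.X : IwasawaAlgebra p) ∉ 𝔭.asIdeal →
      (∃ j : ℕ, 1 ≤ j ∧
        ((((Polynomial.cyclotomic (p ^ j) ℤ).comp (Polynomial.X + 1)).map (Int.castRingHom ℤ_[p]) : Polynomial ℤ_[p]) :
          PowerSeries ℤ_[p]) ∈ 𝔭.asIdeal) →
      (∀ (col' : Chroma) (G' : IwasawaAlgebra p),
        iwasawaToPowerSeries p G' =
          PowerSeries.C (ϖ : ℚ_[p]) * iwasawaToPowerSeries p (chromaticL col' Lsharp Lflat) →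
        G' ∈ 𝔭.asIdeal) →
      Module.lengthAt (IwasawaAlgebra p) (IwasawaAlgebra p ⧸ Ideal.span {G}) 𝔭 ≤
        Module.lengthAt (IwasawaAlgebra p) D.X 𝔭) := by
  refine ⟨stub_katoFineLowerSporadic_of_ledgerDoor ?_ ?_, stub_cyclotomicLowerPosLevel_of_ledgerDoor ?_ ?_⟩
  · intro W _ _ p _ _ _ _ hX κ γ hκ hγ hcv v hv g hg cneg c hH N hN f ϖ Lsharp Lflat hf hϖ hSP I Cs Cf hZ Y 𝔭 h𝔭 hp𝔭
      hcyc hcommon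
    have hT : (PowerSeries.X : IwasawaAlgebra p) ∉ 𝔭.asIdeal := fun hT =>
      hcyc ⟨0, by rwa [coe_map_cyclotomicOmega_zero]⟩
    exact hFα W p hX κ γ hκ hγ hcv v hv g hg cneg c hH N hN f ϖ Lsharp Lflat hf hϖ hSP I Cs Cf hZ Y 𝔭 h𝔭 hp𝔭 hT hcommon
  · intro W _ _ p _ _ _ _ hX κ γ hκ hγ hcv v hv g hg cneg c hH N hN f ϖ Lsharp Lflat hf hϖ hSP I Cs Cf hZ Y 𝔭 h𝔭 hp𝔭
      hcyc hcommon hlt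
    have hT : (PowerSeries.X : IwasawaAlgebra p) ∉ 𝔭.asIdeal := fun hT =>
      hcyc ⟨0, by rwa [coe_map_cyclotomicOmega_zero]⟩
    exact hres W p hX κ γ hκ hγ hcv v hv g hg cneg c hH N hN f ϖ Lsharp Lflat hf hϖ hSP I Cs Cf hZ Y 𝔭 h𝔭 hp𝔭 hT
      hcommon hlt
  · intro W _ _ p _ _ _ _ hX κ γ hκ hγ hcv v hv g hg cneg c hH N hN f ϖ Lsharp Lflat hf hϖ hSP I Cs Cf hZ Y 𝔭 h𝔭 hT
      hΦ hcommon
    obtain ⟨j, hj1, hΦj⟩ := hΦ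
    have hp3 : p = 3 := hX.1
    subst hp3
    exact hFα W 3 hX κ γ hκ hγ hcv v hv g hg cneg c hH N hN f ϖ Lsharp Lflat hf hϖ hSP I Cs Cf hZ Y 𝔭 h𝔭
      (natCast_not_mem_of_cyclotomic_comp_mem 𝔭 h𝔭 hj1 hΦj) hT hcommon
  · intro W _ _ p _ _ _ _ hX κ γ hκ hγ hcv v hv g hg cneg c hH N hN f ϖ Lsharp Lflat hf hϖ hSP I Cs Cf hZ Y 𝔭 h𝔭 hT
      hΦ hcommon hlt
    obtain ⟨j, hj1, hΦj⟩ := hΦ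
    have hp3 : p = 3 := hX.1
    subst hp3
    exact hres W 3 hX κ γ hκ hγ hcv v hv g hg cneg c hH N hN f ϖ Lsharp Lflat hf hϖ hSP I Cs Cf hZ Y 𝔭 h𝔭
      (natCast_not_mem_of_cyclotomic_comp_mem 𝔭 h𝔭 hj1 hΦj) hT hcommon hlt

end Summit.BirchSwinnertonDyer.BirchSwinnertonDyer.Theorems.ChromaticCommonZeros

end
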